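import Summits.CriticalPhenomena.PercolationContinuityZ3.Theorems.PercNearOneGluingNoHeavyLowerTailSunflowerAndrasfaiSafe
import Summits.CriticalPhenomena.PercolationContinuityZ3.Theorems.PercNearOneGluingNoHeavyLowerTailSunflowerAndrasfai
import Summits.CriticalPhenomena.PercolationContinuityZ3.Theorems.PercNearOneGluingNoHeavyLowerTailSunflowerBlowupHom
import HarnessLib

/-!
# `NoHeavyLowerTail` (crux stmt-CriticalPhenomena-4575), abstract sunflower cubic: the ANDRÁSFAI GRAPHS ARE A-SAFE, part 5 —
# the isomorphism with the Cayley presentation and **conjecture (And)**: `andrasfaiSafe_holds : AndrasfaiSafe`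

Support file (seat `prim-ineq-prove-1` gen 42; `--supports stmt-CriticalPhenomena-4575`).  No `sorry`, no named facts, standard axioms
(the import `…SunflowerAndrasfai` is computational only through `safe_andrasfai_one`, which is not used here).
Memo: run/shared/lean/prim/prim-ineq-prove-1/FINDING-BLOWUP-prove1-g42.md §7.

THIS FILE.  `mulMap k` (multiplication by `k+1` on `Fin (3k+2)`), `fd_mulMap`, `mul_fd_mod` (for `d = 3q + r < 3k+2`:
`(k+1)d ≡ q + (k+1)r`), `andrasfai_adj_iff_fd` (adjacency in the Cayley presentation `andrasfai k` of `…SunflowerAndrasfai` iff the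
forward distance is `≡ 1 mod 3`), `arcGraph_adj_mulMap`, the graph isomorphism **`andrasfaiIsoArcGraph : andrasfai k ≃g arcGraph k`**,
and the consequences of `arcGraph_safe` (part 4b):
* **`andrasfaiSafe_holds : AndrasfaiSafe`** — conjecture (And) of `…SunflowerAndrasfai` HOLDS: every Andrásfai graph has an A-safe
  graph core (Lemma A `∏ μ(V_i) ≤ μ(A)^(K-1)` for every number of petals and every product measure);
* `safe_andrasfai_comap` — so does every blow-up of an Andrásfai graph (every triangle-free graph in which each independent set has a
  common neighbour, by Pach's theorem);
* `safe_of_hom_andrasfai` — and every maximal triangle-free graph with a homomorphism into an Andrásfai graph (by Jin and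
  Chen–Jin–Koh: every triangle-free graph with `χ ≤ 3` and minimum degree `> n/3`), via `…SunflowerBlowupHom`.
-/

noncomputable section

namespace Summit.CriticalPhenomena.PercolationContinuityZ3.Theorems.SunflowerPartition

namespace SafeCalc

open Finset

namespace Arc

variable {k : ℕ}

/-! ## The isomorphism `andrasfai k ≃g arcGraph k` and conjecture (And) -/

section Iso

/-- Shifting by `j` only depends on `j % (3k+2)`. -/
theorem sh_mod (a : Fin (3 * k + 2)) (j : ℕ) : sh a j = sh a (j % (3 * k + 2)) := by
  apply Fin.ext; simp only [sh_val]; conv_rhs => rw [Nat.add_mod, Nat.mod_mod]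
  rw [Nat.add_mod]

/-- The vertex map of the isomorphism: multiplication by `k+1` (the inverse of `3` modulo `3k+2`). [this work] -/
def mulMap (k : ℕ) (x : Fin (3 * k + 2)) : Fin (3 * k + 2) := sh 0 ((k + 1) * x.val)

/-- Forward distances are multiplied by `k+1` (mod `3k+2`) under `mulMap`. [this work] -/
theorem fd_mulMap (u v : Fin (3 * k + 2)) : fd (mulMap k u) (mulMap k v) = ((k + 1) * fd u v) % (3 * k + 2) := by
  have hv : v = sh u (fd u v) := (sh_fd u v).symm
  have key : mulMap k v = sh (mulMap k u) ((k + 1) * fd u v) := by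
    apply Fin.ext
    simp only [mulMap, sh_val, Fin.val_zero, zero_add, Nat.mod_add_mod]
    conv_lhs => rw [hv, sh_val]
    rw [Nat.mul_mod, Nat.mod_mod, ← Nat.mul_mod, mul_add]
  rw [key, sh_mod, fd_sh _ (Nat.mod_lt _ (by omega))]

/-- The arithmetic heart: for `d < 3k+2` with `d = 3q + r`, `(k+1)·d ≡ q + (k+1)·r (mod 3k+2)` and the latter is `< 3k+2`. -/
theorem mul_fd_mod (d : ℕ) (hd : d < 3 * k + 2) :
    ((k + 1) * d) % (3 * k + 2) = d / 3 + (k + 1) * (d % 3) := by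
  have hdiv := Nat.div_add_mod d 3
  have hr := Nat.mod_lt d (show 0 < 3 by omega)
  set q := d / 3 with hq
  set r := d % 3 with hrr
  have hq' : 3 * q + r = d := hdiv
  have e : (k + 1) * d = q * (3 * k + 2) + (q + (k + 1) * r) := by
    rw [← hq']; ring
  rw [e, Nat.mul_add_mod']
  · apply Nat.mod_eq_of_lt
    interval_cases r <;> omega

/-- Adjacency in `andrasfai k` in terms of the forward distance: `fd u v ≡ 1 (mod 3)`. [this work] -/
theorem andrasfai_adj_iff_fd (u v : Fin (3 * k + 2)) : (andrasfai k).Adj u v ↔ fd u v % 3 = 1 := by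
  change ((u.val < v.val ∧ (v.val - u.val) % 3 = 1) ∨ (v.val < u.val ∧ (u.val - v.val) % 3 = 1)) ↔ _
  rw [fd_val]
  have hu := u.isLt; have hv := v.isLt
  have hne : u ≠ v → (u : ℕ) ≠ v := fun h e => h (Fin.ext e)
  by_cases h : u ≤ v
  · rw [if_pos h]; rw [Fin.le_def] at h
    constructor
    · rintro (⟨h1, h2⟩ | ⟨h1, h2⟩) <;> omega
    · intro h1
      left; constructor <;> omega
  · rw [if_neg h]; rw [Fin.le_def] at h
    constructor
    · rintro (⟨h1, h2⟩ | ⟨h1, h2⟩) <;> omega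
    · intro h1
      right; constructor <;> omega

/-- Adjacency is transported: `arcGraph.Adj (mulMap u) (mulMap v) ↔ andrasfai.Adj u v`. [this work] -/
theorem arcGraph_adj_mulMap (u v : Fin (3 * k + 2)) : (arcGraph k).Adj (mulMap k u) (mulMap k v) ↔ (andrasfai k).Adj u v := by
  rw [arcGraph_adj, andrasfai_adj_iff_fd]
  have hd := fd_lt u v
  have hr := Nat.mod_lt (fd u v) (show 0 < 3 by omega)
  have hdiv := Nat.div_add_mod (fd u v) 3
  have e1 : fd (mulMap k u) (mulMap k v) = fd u v / 3 + (k + 1) * (fd u v % 3) := by rw [fd_mulMap, mul_fd_mod _ hd]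
  by_cases huv : mulMap k u = mulMap k v
  · have h0 : fd (mulMap k u) (mulMap k v) = 0 := by rw [huv, fd_self]
    rw [e1] at h0
    rw [huv, fd_self]
    generalize hq : fd u v / 3 = q at *
    generalize hr' : fd u v % 3 = r at *
    interval_cases r <;> constructor <;> intro h <;> omega
  · rw [fd_rev_eq huv, e1]
    generalize hq : fd u v / 3 = q at *
    generalize hr' : fd u v % 3 = r at *
    interval_cases r <;> constructor <;> intro h <;> omega

/-- `mulMap` is injective. -/
theorem mulMap_injective : Function.Injective (mulMap k) := by
  intro u v huv
  have h0 : fd (mulMap k u) (mulMap k v) = 0 := by rw [huv, fd_self]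
  rw [fd_mulMap, mul_fd_mod _ (fd_lt u v)] at h0
  have hdiv := Nat.div_add_mod (fd u v) 3
  have hc : (k + 1) * (fd u v % 3) = 0 := by omega
  have hr0 : fd u v % 3 = 0 := by
    rcases Nat.mul_eq_zero.1 hc with h | h
    · omega
    · exact h
  have : fd u v = 0 := by omega
  exact fd_eq_zero_iff.1 this

/-- **The Andrásfai graph (Cayley presentation, generators `≡ 1 mod 3`) is isomorphic to its circular-arc presentation**, via
multiplication by `k+1`. [this work] -/
def andrasfaiIsoArcGraph (k : ℕ) : andrasfai k ≃g arcGraph k where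
  toEquiv := Equiv.ofBijective (mulMap k) (Finite.injective_iff_bijective.1 mulMap_injective)
  map_rel_iff' := fun {a b} => arcGraph_adj_mulMap a b

/-- **THEOREM.  Conjecture (And) holds: every Andrásfai graph has an A-safe graph core** (Lemma A for every number of petals and
every product measure). [this work] -/
theorem andrasfaiSafe_holds : AndrasfaiSafe := fun k p =>
  aSafe_of_embedding (andrasfaiIsoArcGraph k).toEmbedding (fun q => arcGraph_safe k q) p

/-- Hence every blow-up of an Andrásfai graph (every triangle-free graph in which each independent set has a common neighbour,
by Pach's theorem) has an A-safe graph core. [this work] -/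
theorem safe_andrasfai_comap {ι : Type*} [Fintype ι] (k : ℕ) (f : ι → Fin (3 * k + 2)) (p : ι → unitInterval) :
    Safe p (edgeCore ((andrasfai k).comap f)) :=
  safe_andrasfai_comap_of_andrasfaiSafe andrasfaiSafe_holds k f p

/-- And every MAXIMAL triangle-free graph admitting a homomorphism into an Andrásfai graph (by the theorems of Jin and
Chen–Jin–Koh: every triangle-free graph with chromatic number `≤ 3` and minimum degree `> n/3`) has an A-safe core. [this work] -/
theorem safe_of_hom_andrasfai {V : Type*} [Fintype V] {Γ : SimpleGraph V} (k : ℕ) (f : Γ →g andrasfai k)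
    (hΓ : K3Saturated Γ) (p : V → unitInterval) : Safe p (edgeCore Γ) :=
  aSafe_of_hom_of_k3Saturated f (cliqueFree_three_andrasfai k) hΓ (andrasfaiSafe_holds k) p

end Iso

end Arc

end SafeCalc

end Summit.CriticalPhenomena.PercolationContinuityZ3.Theorems.SunflowerPartition
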